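import Summits.AnomalousDissipation.AnomalousDissipation.Theorems.ScalarAnomalySteadySourceFormal.Negative.ShearLimit
import Summits.AnomalousDissipation.AnomalousDissipation.Theorems.ScalarAnomalySteadySourceFormal.Negative.DriftDissipation
import Summits.AnomalousDissipation.AnomalousDissipation.Theorems.ScalarAnomalySteadySourceFormal.Negative.KillShape

/-!
# Negative knowledge for the crux `ScalarAnomalySteadySourceFormal` (stmt-AnomalousDissipation-0448), VII-g:
# honesty of the variance clause for solutions with finite dissipation integral

Certified copy of §9.7 of the cdisprove work file.  The crux's variance clause (v)
`⟨‖θ_j‖²⟩ ≤ E` is a `limsup` of Cesàro means and holds VACUOUSLY when the means are unbounded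
(`Negative.KillShape.longTimeAvgSup_eq_zero_of_tendsto_atTop`).  For solutions whose dissipation
integral `∫⁻_{(0,T)} ‖∇θ‖²` is finite for every `T` (all shear–drift-stirred ones, by
`Negative.ShearTotal.perT_dissipation_le`) the anomaly clause (vi) closes this door: Poincaré
(spectral, `scalarL2Sq_le_grad_add_mean_sq`, proved here from Parseval) and mean conservation
(`Negative.ForcedModes.forced_ae_mFourierCoeff_zero_eq`) give
`timeMean ‖θ‖² ≤ timeMean (ν‖∇θ‖²)/(4π²ν) + (∫θ₀)²` (`timeMean_scalarL2Sq_le`), the floor (vi) bounds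
the dissipation means, so the variance means are eventually `≤ E + δ` (`honest_variance`).

Supports stmt-AnomalousDissipation-0448 (the shear–drift no-go, files `Shear*`).
-/

set_option linter.dupNamespace false

noncomputable section

open scoped BigOperators Topology ENNReal NNReal InnerProductSpace ContDiff
open Filter Set Function MeasureTheory UnitAddTorus Complex

namespace Summit.AnomalousDissipation.AnomalousDissipation.Theorems.ScalarAnomalySteadySourceFormal.Negative

open Literature.Analysis
open Literature.Analysis.FunctionSpaces Literature.Analysis.FunctionSpaces.Torus
open Literature.Analysis.FluidPDE Literature.Analysis.FluidPDE.Torus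

variable {d : Type*} [Fintype d]

section Honest

variable {ν : ℝ} {u : ℝ → UnitAddTorus d → EuclideanSpace ℝ d} {h θ₀ : UnitAddTorus d → ℝ}
  {θ : ℝ → UnitAddTorus d → ℝ}

/-- The zero mode of a real integrable function is its mean. [folklore] -/
theorem mFourierCoeff_zero_ofReal' {f : UnitAddTorus d → ℝ} :
    mFourierCoeff (fun x => (f x : ℂ)) 0 = ((∫ x, f x : ℝ) : ℂ) := by
  rw [FunctionSpaces.Torus.mFourierCoeff_eq_integral_conj_mul]
  simp only [mFourier_zero, ContinuousMap.one_apply, map_one, one_mul]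
  exact integral_complex_ofReal

/-- **Mean conservation, real form**: `∫ θ(t) = ∫ θ₀` for a.e. `t ∈ (0,T)`. [folklore] -/
theorem forced_ae_scalarMean_eq {T : ℝ} (hw : IsWeakScalarTransportForcedOn T ν u (fun _ => h) θ₀ θ)
    (hh : Integrable h volume) (hmean : HasZeroMean h) (hθ₀ : Integrable θ₀ volume) :
    ∀ᵐ t ∂(volume.restrict (Ioo 0 T)), scalarMean (θ t) = scalarMean θ₀ := by
  filter_upwards [forced_ae_mFourierCoeff_zero_eq hw hh hmean hθ₀] with t ht
  rw [mFourierCoeff_zero_ofReal', mFourierCoeff_zero_ofReal'] at ht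
  exact_mod_cast ht

/-- **Spectral Poincaré–Wirtinger, working form**: for `θ ∈ L²` with finite spectral gradient,
`‖θ‖² ≤ ‖∇θ‖²/(4π²) + (∫θ)²` (`|k|² ≥ 1` off the zero mode, Parseval, `θ̂(0) = ∫θ`). [folklore] -/
theorem scalarL2Sq_le_grad_add_mean_sq {f : UnitAddTorus d → ℝ} (hf : MemLp f 2 volume) (hfin : eScalarGradNormSq f ≠ ⊤) :
    scalarL2Sq f ≤ (eScalarGradNormSq f).toReal / (4 * Real.pi ^ 2) + scalarMean f ^ 2 := by
  classical
  -- (a) the gradient dominates `4π² X`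
  have ha : ENNReal.ofReal (4 * Real.pi ^ 2) *
      (∑' k : d → ℤ, (if k = 0 then 0 else ‖mFourierCoeff (fun x => (f x : ℂ)) k‖ₑ ^ 2)) ≤ eScalarGradNormSq f := by
    rw [eScalarGradNormSq_eq_tsum]
    refine mul_le_mul_right (ENNReal.tsum_le_tsum fun k => ?_) _
    by_cases hk : k = 0
    · simp [hk]
    · rw [if_neg hk]
      have h1 : (1 : ℝ≥0∞) ≤ ENNReal.ofReal (FunctionSpaces.Torus.freqNormSq k) := by
        rw [← ENNReal.ofReal_one]
        exact ENNReal.ofReal_le_ofReal (FunctionSpaces.Torus.one_le_freqNormSq_of_ne_zero hk)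
      calc ‖mFourierCoeff (fun x => (f x : ℂ)) k‖ₑ ^ 2 = 1 * ‖mFourierCoeff (fun x => (f x : ℂ)) k‖ₑ ^ 2 := (one_mul _).symm
        _ ≤ ENNReal.ofReal (FunctionSpaces.Torus.freqNormSq k) * ‖mFourierCoeff (fun x => (f x : ℂ)) k‖ₑ ^ 2 := by gcongr
  set X : ℝ≥0∞ := ∑' k : d → ℤ, (if k = 0 then 0 else ‖mFourierCoeff (fun x => (f x : ℂ)) k‖ₑ ^ 2) with hX
  -- (b) Parseval split at the zero mode
  have h0 : ‖mFourierCoeff (fun x => (f x : ℂ)) 0‖ₑ ^ 2 = ENNReal.ofReal (scalarMean f ^ 2) := by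
    rw [mFourierCoeff_zero_ofReal', ← ofReal_norm, ← ENNReal.ofReal_pow (norm_nonneg _), Complex.norm_real,
      Real.norm_eq_abs, sq_abs]
    rfl
  have hsplit : X + ENNReal.ofReal (scalarMean f ^ 2) = ENNReal.ofReal (scalarL2Sq f) := by
    rw [← h0, scalarL2Sq, ← tsum_enorm_sq_mFourierCoeff hf, ENNReal.tsum_eq_add_tsum_ite (0 : d → ℤ), add_comm]
    congr 1
    refine tsum_congr fun k => ?_
    by_cases hk : k = 0 <;> simp [hk]
  have hXeq : X = ENNReal.ofReal (scalarL2Sq f) - ENNReal.ofReal (scalarMean f ^ 2) :=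
    ENNReal.eq_sub_of_add_eq ENNReal.ofReal_ne_top hsplit
  -- (c) assemble in `ℝ`
  have hle : ENNReal.ofReal (4 * Real.pi ^ 2 * (scalarL2Sq f - scalarMean f ^ 2)) ≤ eScalarGradNormSq f := by
    rw [ENNReal.ofReal_mul (by positivity), ENNReal.ofReal_sub _ (sq_nonneg _), ← hXeq]
    exact ha
  have hreal := (ENNReal.ofReal_le_iff_le_toReal hfin).1 hle
  have hπ : 0 < 4 * Real.pi ^ 2 := by positivity
  rw [div_add' _ _ _ hπ.ne', le_div_iff₀ hπ]
  linarith

/-- **Poincaré + mean conservation along the solution**: for a.e. `t ∈ (0,T)` with finite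
gradient, `‖θ(t)‖² ≤ ‖∇θ(t)‖²/(4π²) + (∫θ₀)²`. [folklore] -/
theorem forced_ae_scalarL2Sq_le_grad {T : ℝ} (hw : IsWeakScalarTransportForcedOn T ν u (fun _ => h) θ₀ θ)
    (hh : Integrable h volume) (hmean : HasZeroMean h) (hθ₀ : Integrable θ₀ volume) :
    ∀ᵐ t ∂(volume.restrict (Ioo 0 T)), eScalarGradNormSq (θ t) ≠ ⊤ →
      scalarL2Sq (θ t) ≤ (eScalarGradNormSq (θ t)).toReal / (4 * Real.pi ^ 2) + scalarMean θ₀ ^ 2 := by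
  filter_upwards [forced_ae_memLp_two hw, forced_ae_scalarMean_eq hw hh hmean hθ₀] with t ht hm hfin
  rw [← hm]
  exact scalarL2Sq_le_grad_add_mean_sq ht hfin

/-- **Variance means are controlled by dissipation means** (finite dissipation integral):
`timeMean ‖θ‖² T ≤ timeMean (ν‖∇θ‖²) T / (4π²ν) + (∫θ₀)²`. [folklore] -/
theorem timeMean_scalarL2Sq_le (hw : IsWeakScalarTransportForced ν u (fun _ => h) θ₀ θ) (hν : 0 < ν)
    (hh : Integrable h volume) (hmean : HasZeroMean h) (hθ₀ : Integrable θ₀ volume)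
    {T : ℝ} (hT : 0 < T) (hfin : ∫⁻ t in Ioo 0 T, eScalarGradNormSq (θ t) ≠ ⊤) :
    timeMean (fun t => scalarL2Sq (θ t)) T ≤
      timeMean (fun t => ν * (eScalarGradNormSq (θ t)).toReal) T / (4 * Real.pi ^ 2 * ν) + scalarMean θ₀ ^ 2 := by
  have hwT := hw T hT
  have hGm : AEMeasurable (fun t => eScalarGradNormSq (θ t)) (volume.restrict (Ioo 0 T)) :=
    forced_aemeasurable_eScalarGradNormSq hwT
  have hGi : IntegrableOn (fun t => (eScalarGradNormSq (θ t)).toReal) (Ioo 0 T) volume :=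
    integrable_toReal_of_lintegral_ne_top hGm hfin
  have hae := forced_ae_scalarL2Sq_le_grad hwT hh hmean hθ₀
  have hfin_ae : ∀ᵐ t ∂(volume.restrict (Ioo 0 T)), eScalarGradNormSq (θ t) < ⊤ := ae_lt_top' hGm hfin
  have hint : ∫ t in Ioo 0 T, scalarL2Sq (θ t) ≤
      ∫ t in Ioo 0 T, ((eScalarGradNormSq (θ t)).toReal / (4 * Real.pi ^ 2) + scalarMean θ₀ ^ 2) := by
    refine integral_mono_ae (forced_integrableOn_scalarL2Sq hwT)
      ((hGi.div_const _).add (integrableOn_const (hs := measure_Ioo_lt_top.ne))) ?_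
    filter_upwards [hae, hfin_ae] with t ht hf
    exact ht hf.ne
  rw [integral_add (hGi.div_const _) (integrableOn_const (hs := measure_Ioo_lt_top.ne)), integral_div,
    setIntegral_const, Real.volume_real_Ioo_of_le hT.le, sub_zero, smul_eq_mul] at hint
  have htm : ∀ g : ℝ → ℝ, timeMean g T = T⁻¹ * ∫ t in Ioo 0 T, g t := fun g => by
    rw [timeMean, intervalIntegral.integral_of_le hT.le, integral_Ioc_eq_integral_Ioo]
  rw [htm, htm, integral_const_mul]
  have hTi : 0 < T⁻¹ := inv_pos.2 hT
  calc T⁻¹ * ∫ t in Ioo 0 T, scalarL2Sq (θ t)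
      ≤ T⁻¹ * ((∫ t in Ioo 0 T, (eScalarGradNormSq (θ t)).toReal) / (4 * Real.pi ^ 2) + T * scalarMean θ₀ ^ 2) :=
        mul_le_mul_of_nonneg_left hint hTi.le
    _ = T⁻¹ * (ν * ∫ t in Ioo 0 T, (eScalarGradNormSq (θ t)).toReal) / (4 * Real.pi ^ 2 * ν) + scalarMean θ₀ ^ 2 := by
        field_simp

/-- **HONEST VARIANCE.**  If the dissipation integral is finite on every `(0,T)`, the anomaly floor
`ε ≤ ⟨ν‖∇θ‖²⟩` together with `⟨‖θ‖²⟩ ≤ E` forces the variance means to be eventually `≤ E + δ`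
(no junk). [folklore] -/
theorem honest_variance (hw : IsWeakScalarTransportForced ν u (fun _ => h) θ₀ θ) (hν : 0 < ν)
    (hh : Integrable h volume) (hmean : HasZeroMean h) (hθ₀ : Integrable θ₀ volume)
    (hfin : ∀ T, 0 < T → ∫⁻ t in Ioo 0 T, eScalarGradNormSq (θ t) ≠ ⊤)
    {ε : ℝ} (hε : 0 < ε) (hanom : ε ≤ longTimeAvgSup (fun t => ν * (eScalarGradNormSq (θ t)).toReal))
    {E : ℝ} (hVb : longTimeAvgSup (fun t => scalarL2Sq (θ t)) ≤ E) {δ : ℝ} (hδ : 0 < δ) :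
    ∀ᶠ T in atTop, timeMean (fun t => scalarL2Sq (θ t)) T ≤ E + δ := by
  obtain ⟨D, hD⟩ := isBoundedUnder_timeMean_of_le_longTimeAvgSup hε hanom
  rw [eventually_map] at hD
  have hbdd : IsBoundedUnder (· ≤ ·) atTop (timeMean fun t => scalarL2Sq (θ t)) := by
    refine ⟨D / (4 * Real.pi ^ 2 * ν) + scalarMean θ₀ ^ 2, ?_⟩
    rw [eventually_map]
    filter_upwards [hD, eventually_gt_atTop (0 : ℝ)] with T hT hT0
    refine (timeMean_scalarL2Sq_le hw hν hh hmean hθ₀ hT0 (hfin T hT0)).trans ?_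
    gcongr
  have hlt : limsup (timeMean fun t => scalarL2Sq (θ t)) atTop < E + δ := lt_of_le_of_lt hVb (by linarith)
  exact (eventually_lt_of_limsup_lt hlt hbdd).mono fun T hT => hT.le

/-- The dissipation mean through the dissipation integral:
`timeMean (ν‖∇θ‖²) T = T⁻¹ ν (∫⁻_{(0,T)} ‖∇θ‖²).toReal`. [folklore] -/
theorem timeMean_diss_eq (hw : IsWeakScalarTransportForced ν u (fun _ => h) θ₀ θ) {T : ℝ} (hT : 0 < T)
    (hfin : ∫⁻ t in Ioo 0 T, eScalarGradNormSq (θ t) ≠ ⊤) :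
    timeMean (fun t => ν * (eScalarGradNormSq (θ t)).toReal) T =
      T⁻¹ * (ν * (∫⁻ t in Ioo 0 T, eScalarGradNormSq (θ t)).toReal) := by
  have hGm : AEMeasurable (fun t => eScalarGradNormSq (θ t)) (volume.restrict (Ioo 0 T)) :=
    forced_aemeasurable_eScalarGradNormSq (hw T hT)
  rw [timeMean, intervalIntegral.integral_of_le hT.le, integral_Ioc_eq_integral_Ioo, integral_const_mul,
    integral_toReal hGm (ae_lt_top' hGm hfin)]

end Honest

end Summit.AnomalousDissipation.AnomalousDissipation.Theorems.ScalarAnomalySteadySourceFormal.Negative
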